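import Summits.QuantumAdvantage.QuantumAdvantage.Theorems.MobiusLadderLiouvilleOrthogonalTC0StubAutomaticFamily
import Summits.QuantumAdvantage.QuantumAdvantage.Theorems.MobiusLadderLiouvilleOrthogonalTC0StubScanRung
import HarnessLib

/-!
# Crux `MobiusLadder.LiouvilleOrthogonalTC0` (stmt-QuantumAdvantage-1393), line `Sketch`, skeleton v9.1:
stub `stub_scan_moebius` — the `μ`-twin of the finite-state-scan rung

Kalai's `TC⁰` question is about the Möbius function `μ`; the landed finite-state-scan rung
(`stub_automaticFamily` + `stub_scanRung`) is about the Liouville function `λ`. This file proves the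
`μ`-version, which is in fact the simpler one: the named fact
`Literature.NumberTheory.LFunctions.mullner_moebius_automatic` (C. Müllner, *Automatic sequences
fulfill the Sarnak conjecture*, Duke Math. J. 166 (2017), Thm. 1.2: `∑_{n ≤ N} a(n) μ(n) = o(N)` for
every `k`-automatic `a`, `k ≥ 2`) is natively a statement about `μ`, so no `λ = 𝟙_□ ⋆ μ`
conversion is needed.

Statement. Assuming the named fact, for every number of states `S` and every `ε > 0`, eventually
in `n`, for ALL `S`-state automata `(δ, q₀, τ)` over the alphabet `Bool`, the Boolean function
obtained by scanning the `n` bits `x₀, …, x_{n-1}` of `N < 2ⁿ` (`List.ofFn`, high zero bits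
included) in either direction is `ε 2ⁿ`-orthogonal to `μ` on `N < 2ⁿ`.

Proof. (a) Uniform family bound (`scanMu_family`, the `μ`-twin of `stub_automaticFamily`): each
sequence `m ↦ sgn τ(δ*(q₀, binary digits of m))` is `2`-automatic — MSB-first it is a `dfaoSeq`
(`isAutomaticSeq_dfaoSeq`), LSB-first by `automaticFamily_isAutomaticSeq_foldl` — so Müllner's
theorem bounds `|∑_{m ≤ N} μ(m) sgn τ(…)| ≤ ε N` beyond a threshold (`scanMu_bound`, real form via
`scanMu_abs_sum_eq_norm`); the state depends on `δ : Fin S → ℕ → Fin S` only through its binary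
table (`automaticFamily_foldl_congr`), so the thresholds range over the finite type
`(Fin S → Fin 2 → Fin S) × Fin S × (Fin S → Bool)` and admit a common upper bound
(`Finite.exists_le`). (b) Padded scans, exactly as `stub_scanRung`: dyadic induction on `n`
(`scanMu_dyadic`) — one more high zero bit shifts the output map (LSB) or the start (MSB) within the
family; on the block `2ʲ ≤ N < 2ʲ⁺¹` the padded scan is the automaton reading `Nat.digits 2 N`
(`scanRung_foldl_block`, `scanRung_foldl_reverse_block`), a difference of two partial sums
controlled by (a) (`scanRung_block_bound`, `|μ| ≤ 1`); total `3 ε' 2ⁿ + 2 N₀ n ≤ ε 2ⁿ` for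
`ε' = ε / 6` and `n` large (`scanRung_eventually_linear_le`).
-/

set_option linter.dupNamespace false -- D-0017: single-problem summit ⇒ `QuantumAdvantage.QuantumAdvantage` by design

noncomputable section

namespace Summit.QuantumAdvantage.QuantumAdvantage.Theorems.LiouvilleOrthogonalTC0

open Filter Finset
open Literature.Probability.RandomGraphs.LowDegree (sgn)
open Literature.NumberTheory.LFunctions (IsAutomaticSeq dfaoSeq isAutomaticSeq_dfaoSeq
  mullner_moebius_automatic)

/-! ### (a) Müllner's theorem for `μ`, uniformly over `S`-state automata -/

/-- Passage between the real and the complex form of a `μ`-correlation sum with a real weight `b`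
(embedded in `ℂ`): `|∑_{m ≤ N} μ(m) b(m)| = ‖∑_{n ≤ N} b(n) μ(n)‖`. -/
theorem scanMu_abs_sum_eq_norm (b : ℕ → ℝ) (N : ℕ) :
    |∑ m ∈ Finset.range (N + 1), ((ArithmeticFunction.moebius m : ℤ) : ℝ) * b m| =
      ‖∑ n ∈ Finset.range (N + 1), ((b n : ℝ) : ℂ) * (ArithmeticFunction.moebius n : ℂ)‖ := by
  have h : ∑ n ∈ Finset.range (N + 1), ((b n : ℝ) : ℂ) * (ArithmeticFunction.moebius n : ℂ) =
      ((∑ m ∈ Finset.range (N + 1), ((ArithmeticFunction.moebius m : ℤ) : ℝ) * b m : ℝ) : ℂ) := by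
    rw [Complex.ofReal_sum]
    refine Finset.sum_congr rfl fun n _ => ?_
    rw [Complex.ofReal_mul, Complex.ofReal_intCast, mul_comm]
  rw [h, Complex.norm_real, Real.norm_eq_abs]

/-- Müllner's theorem (the named fact `mullner_moebius_automatic` at `k = 2`) against ONE real
sequence `b` whose complexification is `2`-automatic, in real form:
`|∑_{m ≤ N} μ(m) b(m)| ≤ ε N` for all `N ≥ N₀`. -/
theorem scanMu_bound (hM : mullner_moebius_automatic) {b : ℕ → ℝ}
    (hb : IsAutomaticSeq 2 (fun n => ((b n : ℝ) : ℂ))) {ε : ℝ} (hε : 0 < ε) :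
    ∃ N₀ : ℕ, ∀ N : ℕ, N₀ ≤ N →
      |∑ m ∈ Finset.range (N + 1), ((ArithmeticFunction.moebius m : ℤ) : ℝ) * b m| ≤ ε * N := by
  obtain ⟨N₀, hN₀⟩ := hM 2 le_rfl _ hb ε hε
  refine ⟨N₀, fun N hN => ?_⟩
  rw [scanMu_abs_sum_eq_norm]
  exact hN₀ N hN

/-- **`μ` is orthogonal to every `S`-state automaton scanning the binary digits, uniformly in the
automaton** (the `μ`-twin of `stub_automaticFamily`). Assuming the named fact
`mullner_moebius_automatic` (Müllner 2017, Thm. 1.2), for every `S` and `ε > 0` there is `N₀` such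
that for all `N ≥ N₀` and ALL `(δ, q₀, τ)` — transition map `δ : Fin S → ℕ → Fin S`, start
`q₀ : Fin S`, output `τ : Fin S → Bool` — both `|∑_{m ≤ N} μ(m) sgn τ(δ*(q₀, (m)₂ MSB-first))|` and
`|∑_{m ≤ N} μ(m) sgn τ(δ*(q₀, (m)₂ LSB-first))|` are `≤ ε N`. Each sequence is `2`-automatic
(`isAutomaticSeq_dfaoSeq`, `automaticFamily_isAutomaticSeq_foldl`), so `scanMu_bound` applies; the
state depends on `δ` only through its finite binary table (`automaticFamily_foldl_congr`), so the
thresholds range over the finite type `(Fin S → Fin 2 → Fin S) × Fin S × (Fin S → Bool)` and `N₀`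
is a common upper bound (`Finite.exists_le`). -/
theorem scanMu_family (hM : mullner_moebius_automatic) (S : ℕ) (ε : ℝ) (hε : 0 < ε) :
    ∃ N₀ : ℕ, ∀ N : ℕ, N₀ ≤ N → ∀ (δ : Fin S → ℕ → Fin S) (q₀ : Fin S) (τ : Fin S → Bool),
      |∑ m ∈ Finset.range (N + 1), ((ArithmeticFunction.moebius m : ℤ) : ℝ) *
          sgn (τ ((Nat.digits 2 m).reverse.foldl δ q₀))| ≤ ε * N ∧
      |∑ m ∈ Finset.range (N + 1), ((ArithmeticFunction.moebius m : ℤ) : ℝ) *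
          sgn (τ ((Nat.digits 2 m).foldl δ q₀))| ≤ ε * N := by
  -- extension of a binary transition table `e : Fin S → Fin 2 → Fin S` to all of `ℕ`
  let lift : (Fin S → Fin 2 → Fin S) → Fin S → ℕ → Fin S :=
    fun e q d => e q ⟨d % 2, Nat.mod_lt d two_pos⟩
  -- Müllner's theorem for each member of the family, in both reading directions
  have hMSB : ∀ (e : Fin S → Fin 2 → Fin S) (q₀ : Fin S) (τ : Fin S → Bool), ∃ N₁ : ℕ,
      ∀ N : ℕ, N₁ ≤ N →
        |∑ m ∈ Finset.range (N + 1), ((ArithmeticFunction.moebius m : ℤ) : ℝ) *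
            sgn (τ ((Nat.digits 2 m).reverse.foldl (lift e) q₀))| ≤ ε * N := by
    intro e q₀ τ
    have ha : IsAutomaticSeq 2
        (fun n => ((sgn (τ ((Nat.digits 2 n).reverse.foldl (lift e) q₀)) : ℝ) : ℂ)) :=
      isAutomaticSeq_dfaoSeq (le_refl 2) (lift e) q₀ (fun q => ((sgn (τ q) : ℝ) : ℂ))
    exact scanMu_bound hM ha hε
  have hLSB : ∀ (e : Fin S → Fin 2 → Fin S) (q₀ : Fin S) (τ : Fin S → Bool), ∃ N₂ : ℕ,
      ∀ N : ℕ, N₂ ≤ N →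
        |∑ m ∈ Finset.range (N + 1), ((ArithmeticFunction.moebius m : ℤ) : ℝ) *
            sgn (τ ((Nat.digits 2 m).foldl (lift e) q₀))| ≤ ε * N := by
    intro e q₀ τ
    have ha : IsAutomaticSeq 2
        (fun n => ((sgn (τ ((Nat.digits 2 n).foldl (lift e) q₀)) : ℝ) : ℂ)) :=
      automaticFamily_isAutomaticSeq_foldl (le_refl 2) (lift e) q₀ (fun q => ((sgn (τ q) : ℝ) : ℂ))
    exact scanMu_bound hM ha hε
  choose N₁ hN₁ using hMSB
  choose N₂ hN₂ using hLSB
  -- a common threshold over the finite family of binary tables, starts and outputs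
  obtain ⟨M₁, hM₁⟩ := Finite.exists_le
    (fun p : (Fin S → Fin 2 → Fin S) × Fin S × (Fin S → Bool) => N₁ p.1 p.2.1 p.2.2)
  obtain ⟨M₂, hM₂⟩ := Finite.exists_le
    (fun p : (Fin S → Fin 2 → Fin S) × Fin S × (Fin S → Bool) => N₂ p.1 p.2.1 p.2.2)
  refine ⟨max M₁ M₂, fun N hN δ q₀ τ => ?_⟩
  -- `δ` acts on binary words exactly as the extension of its binary table `e`
  let e : Fin S → Fin 2 → Fin S := fun q b => δ q b.val
  have hδ : ∀ q : Fin S, ∀ d : ℕ, d < 2 → δ q d = lift e q d := by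
    intro q d hd
    show δ q d = δ q (d % 2)
    rw [Nat.mod_eq_of_lt hd]
  have hdig : ∀ m : ℕ, ∀ d ∈ Nat.digits 2 m, d < 2 := fun m d hd =>
    Nat.digits_lt_base one_lt_two hd
  have hrev : ∀ m : ℕ, (Nat.digits 2 m).reverse.foldl δ q₀ =
      (Nat.digits 2 m).reverse.foldl (lift e) q₀ := fun m =>
    automaticFamily_foldl_congr hδ _ (fun d hd => hdig m d (List.mem_reverse.mp hd)) q₀
  have hfwd : ∀ m : ℕ, (Nat.digits 2 m).foldl δ q₀ = (Nat.digits 2 m).foldl (lift e) q₀ :=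
    fun m => automaticFamily_foldl_congr hδ _ (hdig m) q₀
  have h1 : N₁ e q₀ τ ≤ N := le_trans (le_trans (hM₁ (e, q₀, τ)) (le_max_left _ _)) hN
  have h2 : N₂ e q₀ τ ≤ N := le_trans (le_trans (hM₂ (e, q₀, τ)) (le_max_right _ _)) hN
  have hsum1 : ∑ m ∈ Finset.range (N + 1), ((ArithmeticFunction.moebius m : ℤ) : ℝ) *
        sgn (τ ((Nat.digits 2 m).reverse.foldl δ q₀)) =
      ∑ m ∈ Finset.range (N + 1), ((ArithmeticFunction.moebius m : ℤ) : ℝ) *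
        sgn (τ ((Nat.digits 2 m).reverse.foldl (lift e) q₀)) :=
    Finset.sum_congr rfl fun m _ => by rw [hrev m]
  have hsum2 : ∑ m ∈ Finset.range (N + 1), ((ArithmeticFunction.moebius m : ℤ) : ℝ) *
        sgn (τ ((Nat.digits 2 m).foldl δ q₀)) =
      ∑ m ∈ Finset.range (N + 1), ((ArithmeticFunction.moebius m : ℤ) : ℝ) *
        sgn (τ ((Nat.digits 2 m).foldl (lift e) q₀)) :=
    Finset.sum_congr rfl fun m _ => by rw [hfwd m]
  refine ⟨?_, ?_⟩
  · rw [hsum1]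
    exact hN₁ e q₀ τ N h1
  · rw [hsum2]
    exact hN₂ e q₀ τ N h2

/-! ### (b) Bookkeeping for the padded scans -/

/-- `|μ(m) · sgn b| ≤ 1` (`|μ| ≤ 1`: Mathlib's `ArithmeticFunction.abs_moebius_le_one`). -/
theorem scanMu_abs_term_le (m : ℕ) (b : Bool) :
    |((ArithmeticFunction.moebius m : ℤ) : ℝ) * sgn b| ≤ 1 := by
  rw [abs_mul]
  have hb : |sgn b| = 1 := by cases b <;> simp
  rw [hb, mul_one]
  exact_mod_cast ArithmeticFunction.abs_moebius_le_one

/-- Dyadic induction (the `μ`-twin of `scanRung_dyadic`): if lengthening the scan by one (zero) bit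
amounts to a shift `sh` of the parameter, and every dyadic block is bounded by `a 2ⁿ + b` uniformly
in the parameter, then `|Σ_{N < 2ⁿ} μ(N) G p n N| ≤ a (2ⁿ - 1) + b n`. -/
theorem scanMu_dyadic {P : Type*} (G : P → ℕ → ℕ → ℝ) (sh : P → P) (a b : ℝ)
    (hG : ∀ (p : P) (n N : ℕ), N < 2 ^ n → G p (n + 1) N = G (sh p) n N)
    (hB : ∀ (p : P) (n : ℕ), |∑ N ∈ Ico (2 ^ n) (2 ^ (n + 1)),
      ((ArithmeticFunction.moebius N : ℤ) : ℝ) * G p (n + 1) N| ≤ a * 2 ^ n + b) :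
    ∀ (n : ℕ) (p : P), |∑ N ∈ range (2 ^ n), ((ArithmeticFunction.moebius N : ℤ) : ℝ) * G p n N|
      ≤ a * (2 ^ n - 1) + b * n := by
  intro n
  induction n with
  | zero => intro p; simp
  | succ n ih =>
    intro p
    have hle : 2 ^ n ≤ 2 ^ (n + 1) := Nat.pow_le_pow_right (by norm_num) (Nat.le_succ n)
    rw [← Finset.sum_range_add_sum_Ico _ hle]
    have hlow : ∑ N ∈ range (2 ^ n), ((ArithmeticFunction.moebius N : ℤ) : ℝ) * G p (n + 1) N
        = ∑ N ∈ range (2 ^ n), ((ArithmeticFunction.moebius N : ℤ) : ℝ) * G (sh p) n N :=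
      Finset.sum_congr rfl fun N hN => by rw [hG p n N (mem_range.mp hN)]
    rw [hlow]
    calc _ ≤ |∑ N ∈ range (2 ^ n), ((ArithmeticFunction.moebius N : ℤ) : ℝ) * G (sh p) n N|
          + |∑ N ∈ Ico (2 ^ n) (2 ^ (n + 1)),
              ((ArithmeticFunction.moebius N : ℤ) : ℝ) * G p (n + 1) N| := abs_add_le _ _
      _ ≤ (a * (2 ^ n - 1) + b * n) + (a * 2 ^ n + b) := add_le_add (ih (sh p)) (hB p n)
      _ = a * (2 ^ (n + 1) - 1) + b * (n + 1 : ℕ) := by push_cast; ring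

/-! ### The stub -/

/-- **Stub `stub_scan_moebius` (line `Sketch`, v9.1) — the `μ`-twin of the finite-state-scan rung:
padded finite-state scans of the `n` input bits are orthogonal to the Möbius function, modulo
Müllner's theorem.** Assuming the named fact `mullner_moebius_automatic` (Müllner 2017, Thm. 1.2),
for every `S` and `ε > 0`, eventually in `n`, for ALL `S`-state automata `(δ, q₀, τ)` over the
alphabet `Bool`, the function scanning the bits `x₀, x₁, …, x_{n-1}` (`List.ofFn`, LSB first, the
high zero bits included) and the one scanning `x_{n-1}, …, x₀` are both `ε 2ⁿ`-orthogonal to `μ` on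
`N < 2ⁿ`. From the uniform family bound `scanMu_family` by dyadic induction on `n`
(`scanMu_dyadic`): one more high zero bit shifts the output map (LSB, `scanRung_foldl_succ`) or the
initial state (MSB, `scanRung_foldl_reverse_succ`) within the same finite family; on the block
`2ʲ ≤ N < 2ʲ⁺¹` the padded scan is the automaton reading `Nat.digits 2 N` (`scanRung_foldl_block`,
`scanRung_foldl_reverse_block`), a difference of two partial sums controlled by `scanMu_family`
(`scanRung_block_bound`); total `3 ε' 2ⁿ + 2 N₀ n ≤ ε 2ⁿ` (`scanRung_eventually_linear_le`). -/
theorem stub_scan_moebius (hM : Literature.NumberTheory.LFunctions.mullner_moebius_automatic) (S : ℕ) :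
    ∀ ε : ℝ, 0 < ε → ∀ᶠ n : ℕ in atTop,
      ∀ (δ : Fin S → Bool → Fin S) (q₀ : Fin S) (τ : Fin S → Bool),
        |∑ N ∈ Finset.range (2 ^ n), ((ArithmeticFunction.moebius N : ℤ) : ℝ) *
            sgn (τ (List.foldl δ q₀ (List.ofFn fun i : Fin n => Nat.testBit N i)))| ≤ ε * (2 : ℝ) ^ n ∧
        |∑ N ∈ Finset.range (2 ^ n), ((ArithmeticFunction.moebius N : ℤ) : ℝ) *
            sgn (τ (List.foldl δ q₀ (List.ofFn fun i : Fin n => Nat.testBit N i).reverse))| ≤ ε * (2 : ℝ) ^ n := by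
  intro ε hε
  have hε' : (0 : ℝ) < ε / 6 := by positivity
  obtain ⟨N₀, hN₀⟩ := scanMu_family hM S (ε / 6) hε'
  filter_upwards [scanRung_eventually_linear_le (2 * N₀ : ℝ) (half_pos hε)] with n hn δ q₀ τ
  -- the digit automaton of the family
  set δ' : Fin S → ℕ → Fin S := fun q d => δ q (decide (d = 1))
  constructor
  · -- LSB-first: shift the output map
    have key := scanMu_dyadic (P := Fin S → Bool)
      (fun τ' n N => sgn (τ' (List.foldl δ q₀ (List.ofFn fun i : Fin n => Nat.testBit N i))))
      (fun τ' q => τ' (δ q false)) (3 * (ε / 6)) (2 * N₀)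
      (fun τ' n N hN => by simp only [scanRung_foldl_succ δ q₀ hN])
      (fun τ' n => by
        rw [Finset.sum_congr rfl fun N hN => by
          rw [scanRung_foldl_block δ q₀ (mem_Ico.mp hN).1 (mem_Ico.mp hN).2]]
        exact scanRung_block_bound hε'.le (fun m => scanMu_abs_term_le m _)
          (fun M hM => (hN₀ M hM δ' q₀ τ').2) n)
      n τ
    calc _ ≤ 3 * (ε / 6) * (2 ^ n - 1) + 2 * N₀ * n := key
      _ ≤ 3 * (ε / 6) * 2 ^ n + ε / 2 * 2 ^ n := add_le_add (by linarith) hn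
      _ = ε * 2 ^ n := by ring
  · -- MSB-first: shift the initial state
    have key := scanMu_dyadic (P := Fin S)
      (fun q n N => sgn (τ (List.foldl δ q (List.ofFn fun i : Fin n => Nat.testBit N i).reverse)))
      (fun q => δ q false) (3 * (ε / 6)) (2 * N₀)
      (fun q n N hN => by simp only [scanRung_foldl_reverse_succ δ q hN])
      (fun q n => by
        rw [Finset.sum_congr rfl fun N hN => by
          rw [scanRung_foldl_reverse_block δ q (mem_Ico.mp hN).1 (mem_Ico.mp hN).2]]
        exact scanRung_block_bound hε'.le (fun m => scanMu_abs_term_le m _)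
          (fun M hM => (hN₀ M hM δ' q τ).1) n)
      n q₀
    calc _ ≤ 3 * (ε / 6) * (2 ^ n - 1) + 2 * N₀ * n := key
      _ ≤ 3 * (ε / 6) * 2 ^ n + ε / 2 * 2 ^ n := add_le_add (by linarith) hn
      _ = ε * 2 ^ n := by ring

end Summit.QuantumAdvantage.QuantumAdvantage.Theorems.LiouvilleOrthogonalTC0

end
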